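import Summits.QuantumFields.YangMills.Theorems.BalabanUVNodesN15CurvedDressedPair
import Summits.QuantumFields.YangMills.Theorems.BalabanUVNodesN15CurvedGaugeCovariance
import HarnessLib

/-!
# Route «BalabanUVNodes» (cluster K4 «SpineRates»), Track-A DAG node N15 = NE2, BACKGROUND LAYER — THE η-DEFECT OF THE DRESSED PAIR AT A CURVED BASE POINT: NE2⁺ (entries 0∕1,
# block-defect form) PROPAGATES from the background `U` to the perturbed background `U′U`, the rate degrading linearly in the η-fits of the perturbation's field, of its
# covariant gradient and of the background transporters (two lattice spacings; M1's `hasMaj_idef_bgPairM` inhabited with COVARIANT pieces and file 1's exact coefficients)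

Cell `pub-ymgap`, seat `pub-ymgap-dag-n15-w3` (WIDTH SEAT 3∕3 on node N15, director-ym №197 ∕ HUMAN RULING D-0149; plan g77 `W-SEAT-START-LIST.md` §n15 item 3
«`NE2PlusOperator` for the background layer at GENERAL small-field U» — fourth piece).  `bears_on: R4∕N15 · K3⁷ SpineGivenEndpointR13SepCoPH (stmt-QuantumFields-20544)`.
Filed `--kind proof --supports stmt-QuantumFields-20544 --as helper` — COUNT-NEUTRAL.  Imports BY NAME this seat's files 2 `…N15CurvedDressedPair` (p585823: `covPieces`, `curvDressed`,
`curvRowLetter`; through it file 1 `curvCoefA`, `curvCoefC`, `conjDef`, `covShiftDefect`, `curvCoefC_eq_cancel`, the row letters, and dag-n15-c M1 `hasMaj_idef_bgPairM`) and 3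
`…N15CurvedGaugeCovariance` (`abs_mul_mul_entry_le`); nothing in the tree is modified.

WHY.  The spine's NE2⁺ is an η-DIFFERENCE estimate: the same object at two lattice spacings `η′ ≤ η` compared through the block pull-back (`T4EtaRateDefect.idef`).  M1's
`hasMaj_idef_bgPairM` (dag-n15-c) bounds the η-defect of a Neumann-dressed pair by (a) the η-defects of its pieces and derived pieces, (b) the ROW FITS of its coefficients — for
ARBITRARY derived pieces, but inhabited so far only at the FLAT base point.  Files 1–2 put Bałaban's (3.52)–(3.65) at a CURVED base point `U` (transporters `R`): derived pieces
= the background's covariant derivatives `D^±_{R}G(U)` (`covPieces`), coefficients = the exact curved ones (`curvCoefA`, `curvCoefC`).  THIS FILE inhabits M1's η-defect theorem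
there: the η-defect of the dressed pair `X̂(U′U)` is bounded by the η-defects of `(G(U), D^±_RG(U))` AT `U` (entries 0∕1 of NE2⁺ at the base point, in block form — HYPOTHESES)
times a constant, plus the coefficient fits times a constant; and §1 DERIVES the coefficient fits from transporter-level η-fits by Leibniz: the fit of the perturbation's field
`a⁺ = η⁻¹(S − 1)` (plain and translated along `e_μ⁻¹` — the lineage's (C3)-type transport letters), the fit of its covariant-gradient field `η⁻²(S_μ − R₋ᵀS₋R₋)`, and the
TRANSLATED fit of the background transporters `R_μ(· − e_μ)` (an NE3-type letter of the background itself).  So NE2⁺ (entries 0∕1) PROPAGATES from `U` to `U′U`.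

* §1 fits: `curvCoefA_inr_eq` (`a⁻_μ(x) = −R₋ᵀ(a⁺_μ(x − e_μ))ᵀR₋`), `conj_sub_conj_eq` (three-term Leibniz), `abs_transpose_entry_le`, ★ `rowFit_curvCoefA_inl`, ★ `rowFit_curvCoefA_inr`
  (`≤ |ι|³(2p·o_R + o_t)`), `curvCoefC_eq_neg_sum` (`c = −Σ_μ[a⁺_μa⁺_μᵀ + g_μᵀ]`, `g_μ = η⁻²·covShiftDefect`, from file 1's cancellation), `abs_mul_transpose_fit_le`, ★ `rowFit_curvCoefC`
  (`≤ |ι||J|(2|ι|p·o_a + o_g)`); `curvFitLetter` (one fit letter for all coefficients) with `rowFit_curvCoef_le_letter`;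
* §2 ★★★ `hasMaj_idef_curvDressed` — M1's `hasMaj_idef_bgPairM` at the curved base point: the η-defect of `curvDressed` through `(pull (liftMap π ι), pull (liftPair (liftMap π ι)))`
  is `≤ (m·K₁ + o·K₂)(1 − q)⁻¹·e^{−ρd}` with `m` the η-defect letter of `(G, D^±_RG)` at the base point, `o = curvFitLetter …`, `q = β·r_V(1 + |J ⊕ J|)·c_r < 1`.

HONEST FRAMING ∕ LIMITS.  Bookkeeping over M1's theorem with hypothesis-SHAPED letters ([B9] (3.35)–(3.37) p. 396, (3.42) p. 397, (3.52)–(3.53) p. 400, (3.63)–(3.65) pp. 402–403 =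
SHAPES ∕ MECHANISM; nothing of [B9] asserted): the (3.42)₀,₁-shaped majorants AND η-defects of `G(U)`, `D^±_RG(U)` at the curved base point, the transporter letters and the
transporter fits are DISPLAYED hypotheses; crude constants; the base case `U ≡ 1` is the lineage's (dag-n15-c FILES 24∕30), the passage from the cube-wise gauges of (3.35) to a
global estimate is [B6]'s gluing (untouched; file 3 gives the covariance).  NE2⁺ NOT PRINTED, NOT proved; N15 NOT discharged; counts of record UNMOVED (typed 28∕28 · discharged
5∕27); one finite 𝕋⁴ at fixed ε — NOT infinite volume, NOT OS on ℝ⁴, NOT a mass gap, NOT Clay; R4 closes the conditional finite-𝕋⁴ rung `BalabanLadder.UV` only.  Restate-immune.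
-/

set_option autoImplicit false

noncomputable section
open scoped BigOperators Matrix
open Finset

namespace Summit.QuantumFields.YangMills.BalabanUVNodes.N15.CurvedSpecies

open Literature.MathematicalPhysics.QuantumFieldTheory.Balaban1983to89
open Literature.MathematicalPhysics.QuantumFieldTheory.Balaban1983to89.B11SectG (BlockNorm HasMaj RowSum)
open Literature.MathematicalPhysics.QuantumFieldTheory.Balaban1983to89.T4EtaRateDefect (idef)
open Literature.MathematicalPhysics.QuantumFieldTheory.Balaban1983to89.T4EtaRateCoeffDefect (pull)
open Literature.MathematicalPhysics.QuantumFieldTheory.Balaban1983to89.B6RandomWalk (Triangle254)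
open Summit.QuantumFields.YangMills.BalabanUVNodes.N15.MatrixSpecies (liftMap liftBlk liftEquiv)
open Summit.QuantumFields.YangMills.BalabanUVNodes.N15.MatrixSpecies (covD)
open Summit.QuantumFields.YangMills.BalabanUVNodes.N15.BackgroundLayer (liftPair blkPair hasMaj_idef_bgPairM bgPairM fgrad bgrad tCoefA tCoefC stack unstackM projO
  projO_none_bgPairM projO_some_bgPairM hasMaj_projO_comp)

variable {X X' ι J : Type} [Fintype ι] [DecidableEq ι] [Fintype J]

/-! ## §1 Row fits of the exact curved coefficients from transporter-level η-fits -/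

section Fits

variable (η η' : ℝ) (τ : J → X ≃ X) (τ' : J → X' ≃ X') (π : X' → X) (R S : J → X → Matrix ι ι ℝ) (R' S' : J → X' → Matrix ι ι ℝ)

omit [Fintype J] in
/-- THE BACKWARD COEFFICIENT THROUGH THE FORWARD ONE: `a⁻_μ(x) = −R₋ᵀ·(a⁺_μ(x − e_μ))ᵀ·R₋` (`a⁺ = η⁻¹(S − 1)`, `R₋ = R_μ(x − e_μ)`). [folklore] -/
theorem curvCoefA_inr_eq (μ : J) (x : X) :
    curvCoefA η τ R S (Sum.inr μ) x = -((R μ ((τ μ).symm x))ᵀ * (curvCoefA η τ R S (Sum.inl μ) ((τ μ).symm x))ᵀ * R μ ((τ μ).symm x)) := by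
  rw [curvCoefA_inr, curvCoefA_inl, conjDef, Matrix.transpose_smul, Matrix.transpose_sub, Matrix.transpose_one, Matrix.mul_smul, Matrix.smul_mul, ← smul_neg,
    ← neg_sub, Matrix.mul_neg, Matrix.neg_mul]

omit [Fintype J] [DecidableEq ι] in
/-- THREE-TERM LEIBNIZ for a conjugate: `P′ᵀM′P′ − PᵀMP = (P′ − P)ᵀM′P′ + Pᵀ(M′ − M)P′ + PᵀM(P′ − P)`. [folklore] -/
theorem conj_sub_conj_eq (P P' M M' : Matrix ι ι ℝ) :
    P'ᵀ * M' * P' - Pᵀ * M * P = (P' - P)ᵀ * M' * P' + Pᵀ * (M' - M) * P' + Pᵀ * M * (P' - P) := by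
  rw [Matrix.transpose_sub]
  simp only [Matrix.sub_mul, Matrix.mul_sub]
  abel

omit [Fintype ι] [DecidableEq ι] [Fintype J] in
/-- Entrywise bounds pass to the transpose. [folklore] -/
theorem abs_transpose_entry_le {M : Matrix ι ι ℝ} {m : ℝ} (hM : ∀ i j, |M i j| ≤ m) (i j : ι) : |Mᵀ i j| ≤ m := by
  rw [Matrix.transpose_apply]; exact hM j i

omit [Fintype ι] [DecidableEq ι] [Fintype J] in
/-- Entrywise bounds of a difference pass to the transposes' difference. [folklore] -/
theorem abs_transpose_sub_entry_le {M M' : Matrix ι ι ℝ} {o : ℝ} (h : ∀ i j, |(M' - M) i j| ≤ o) (i j : ι) : |(M'ᵀ - Mᵀ) i j| ≤ o := by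
  rw [← Matrix.transpose_sub, Matrix.transpose_apply]; exact h j i

omit [DecidableEq ι] [Fintype J] in
/-- A row sum from an entrywise bound. [folklore] -/
theorem rowSum_le_of_entry_le {M : Matrix ι ι ℝ} {m : ℝ} (hM : ∀ i j, |M i j| ≤ m) (i : ι) : ∑ j, |M i j| ≤ (Fintype.card ι : ℝ) * m := by
  calc ∑ j, |M i j| ≤ ∑ _j : ι, m := Finset.sum_le_sum fun j _ => hM i j
    _ = (Fintype.card ι : ℝ) * m := by rw [Finset.sum_const, Finset.card_univ, nsmul_eq_mul]

omit [Fintype J] in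
/-- ★ ROW FIT OF THE FORWARD COEFFICIENT from the plain η-fit of the field `a⁺ = η⁻¹(S − 1)` (entrywise `≤ o_a`): `≤ |ι|·o_a`. [cite: Balaban1985BackgroundPropagators, (3.35)–(3.37) p.396 (shape)] -/
theorem rowFit_curvCoefA_inl {oa : ℝ}
    (hfa : ∀ μ x' i j, |(curvCoefA η' τ' R' S' (Sum.inl μ) x' - curvCoefA η τ R S (Sum.inl μ) (π x')) i j| ≤ oa) (μ : J) (x' : X') (i : ι) :
    ∑ j, |curvCoefA η' τ' R' S' (Sum.inl μ) x' i j - curvCoefA η τ R S (Sum.inl μ) (π x') i j| ≤ (Fintype.card ι : ℝ) * oa :=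
  rowSum_le_of_entry_le (M := curvCoefA η' τ' R' S' (Sum.inl μ) x' - curvCoefA η τ R S (Sum.inl μ) (π x')) (fun i j => hfa μ x' i j) i

omit [Fintype J] in
/-- ★ ROW FIT OF THE BACKWARD COEFFICIENT from the TRANSLATED η-fit of `a⁺` along `e_μ⁻¹` (`≤ o_t`), the TRANSLATED η-fit of the background transporters (`≤ o_R`), the field letter
`|a⁺| ≤ p` on both grids and `|R|, |R′| ≤ 1`: `≤ |ι|³·(p·o_R + o_t + p·o_R)` (three-term Leibniz). [cite: Balaban1985BackgroundPropagators, (3.35)–(3.37) p.396 (shape)] -/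
theorem rowFit_curvCoefA_inr {p oat oR : ℝ} (hR1 : ∀ μ x i j, |R μ x i j| ≤ 1) (hR1' : ∀ μ x' i j, |R' μ x' i j| ≤ 1)
    (hp : ∀ μ x i j, |curvCoefA η τ R S (Sum.inl μ) x i j| ≤ p) (hp' : ∀ μ x' i j, |curvCoefA η' τ' R' S' (Sum.inl μ) x' i j| ≤ p)
    (hfat : ∀ μ x' i j, |(curvCoefA η' τ' R' S' (Sum.inl μ) ((τ' μ).symm x') - curvCoefA η τ R S (Sum.inl μ) ((τ μ).symm (π x'))) i j| ≤ oat)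
    (hfR : ∀ μ x' i j, |(R' μ ((τ' μ).symm x') - R μ ((τ μ).symm (π x'))) i j| ≤ oR) (μ : J) (x' : X') (i : ι) :
    ∑ j, |curvCoefA η' τ' R' S' (Sum.inr μ) x' i j - curvCoefA η τ R S (Sum.inr μ) (π x') i j| ≤
      (Fintype.card ι : ℝ) ^ 3 * (oR * p * 1 + 1 * oat * 1 + 1 * p * oR) := by
  set P := R μ ((τ μ).symm (π x')) with hP
  set P' := R' μ ((τ' μ).symm x') with hP'
  set M := (curvCoefA η τ R S (Sum.inl μ) ((τ μ).symm (π x')))ᵀ with hM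
  set M' := (curvCoefA η' τ' R' S' (Sum.inl μ) ((τ' μ).symm x'))ᵀ with hM'
  have hdiff : curvCoefA η' τ' R' S' (Sum.inr μ) x' - curvCoefA η τ R S (Sum.inr μ) (π x') = -(P'ᵀ * M' * P' - Pᵀ * M * P) := by
    rw [curvCoefA_inr_eq, curvCoefA_inr_eq, ← hP, ← hP', ← hM, ← hM', neg_sub_neg, neg_sub]
  have hent : ∀ i j, |(curvCoefA η' τ' R' S' (Sum.inr μ) x' - curvCoefA η τ R S (Sum.inr μ) (π x')) i j| ≤
      (Fintype.card ι : ℝ) ^ 2 * (oR * p * 1 + 1 * oat * 1 + 1 * p * oR) := fun i j => by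
    rw [hdiff, Matrix.neg_apply, abs_neg, conj_sub_conj_eq, Matrix.add_apply, Matrix.add_apply]
    have h1 := abs_mul_mul_entry_le (A := (P' - P)ᵀ) (B := M') (C := P') (abs_transpose_sub_entry_le (M := P) (M' := P') (hfR μ x'))
      (abs_transpose_entry_le (hp' μ ((τ' μ).symm x'))) (hR1' μ ((τ' μ).symm x')) i j
    have h2 := abs_mul_mul_entry_le (A := Pᵀ) (B := M' - M) (C := P') (abs_transpose_entry_le (hR1 μ ((τ μ).symm (π x'))))
      (abs_transpose_sub_entry_le (fun i j => hfat μ x' i j)) (hR1' μ ((τ' μ).symm x')) i j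
    have h3 := abs_mul_mul_entry_le (A := Pᵀ) (B := M) (C := P' - P) (abs_transpose_entry_le (hR1 μ ((τ μ).symm (π x'))))
      (abs_transpose_entry_le (hp μ ((τ μ).symm (π x')))) (fun i j => hfR μ x' i j) i j
    calc _ ≤ |((P' - P)ᵀ * M' * P') i j| + |(Pᵀ * (M' - M) * P') i j| + |(Pᵀ * M * (P' - P)) i j| := abs_add_three _ _ _
      _ ≤ _ := by rw [mul_add, mul_add]; exact add_le_add (add_le_add h1 h2) h3
  calc ∑ j, |curvCoefA η' τ' R' S' (Sum.inr μ) x' i j - curvCoefA η τ R S (Sum.inr μ) (π x') i j|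
      ≤ ∑ _j : ι, (Fintype.card ι : ℝ) ^ 2 * (oR * p * 1 + 1 * oat * 1 + 1 * p * oR) := Finset.sum_le_sum fun j _ => by rw [← Matrix.sub_apply]; exact hent i j
    _ = (Fintype.card ι : ℝ) ^ 3 * (oR * p * 1 + 1 * oat * 1 + 1 * p * oR) := by rw [Finset.sum_const, Finset.card_univ, nsmul_eq_mul]; ring

/-- THE ZEROTH-ORDER COEFFICIENT THROUGH THE FIELD AND ITS COVARIANT GRADIENT (file 1's cancellation, orthogonal `S`, `R`): `c = −Σ_μ[a⁺_μ·a⁺_μᵀ + g_μᵀ]`,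
`g_μ = η⁻²·(S_μ − R₋ᵀS₋R₋)`. [cite: Balaban1985BackgroundPropagators, (3.52) p.400 (shape)] -/
theorem curvCoefC_eq_neg_sum (hS : ∀ μ x, S μ x * (S μ x)ᵀ = 1) (hR : ∀ μ x, (R μ x)ᵀ * R μ x = 1) (x : X) :
    curvCoefC η τ R S x = -∑ μ, (curvCoefA η τ R S (Sum.inl μ) x * (curvCoefA η τ R S (Sum.inl μ) x)ᵀ + ((η⁻¹ * η⁻¹) • covShiftDefect τ R S μ x)ᵀ) := by
  rw [curvCoefC_eq_cancel τ R S η hS hR x, Finset.smul_sum]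
  refine congrArg _ (Finset.sum_congr rfl fun μ _ => ?_)
  rw [smul_add, curvCoefA_inl, Matrix.transpose_smul, Matrix.transpose_smul, Matrix.smul_mul, Matrix.mul_smul, smul_smul, Matrix.transpose_sub, Matrix.transpose_one,
    Matrix.transpose_sub, Matrix.transpose_one]
  congr 1
  rw [show (S μ x - 1) * ((S μ x)ᵀ - 1) = (1 - S μ x) * (1 - (S μ x)ᵀ) from by noncomm_ring]

omit [DecidableEq ι] [Fintype J] in
/-- FIT OF A PRODUCT `aaᵀ`: `|(a′a′ᵀ − aaᵀ)_{ij}| ≤ |ι|·(o·p + p·o)` from `|a|, |a′| ≤ p`, `|a′ − a| ≤ o` (Leibniz `a′a′ᵀ − aaᵀ = (a′ − a)a′ᵀ + a(a′ − a)ᵀ`). [folklore] -/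
theorem abs_mul_transpose_fit_le {A A' : Matrix ι ι ℝ} {p o : ℝ} (hA : ∀ i j, |A i j| ≤ p) (hA' : ∀ i j, |A' i j| ≤ p) (ho : ∀ i j, |(A' - A) i j| ≤ o) (i j : ι) :
    |(A' * A'ᵀ - A * Aᵀ) i j| ≤ (Fintype.card ι : ℝ) * (o * p + p * o) := by
  have hsplit : A' * A'ᵀ - A * Aᵀ = (A' - A) * A'ᵀ + A * (A' - A)ᵀ := by
    rw [Matrix.transpose_sub, Matrix.sub_mul, Matrix.mul_sub]; abel
  rw [hsplit, Matrix.add_apply, Matrix.mul_apply, Matrix.mul_apply]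
  have h1 : ∀ k, |(A' - A) i k * A'ᵀ k j| ≤ o * p := fun k => by
    rw [abs_mul, Matrix.transpose_apply]; exact mul_le_mul (ho i k) (hA' j k) (abs_nonneg _) ((abs_nonneg _).trans (ho i k))
  have h2 : ∀ k, |A i k * (A' - A)ᵀ k j| ≤ p * o := fun k => by
    rw [abs_mul, Matrix.transpose_apply]; exact mul_le_mul (hA i k) (ho j k) (abs_nonneg _) ((abs_nonneg _).trans (hA i k))
  calc |∑ k, (A' - A) i k * A'ᵀ k j + ∑ k, A i k * (A' - A)ᵀ k j|
      ≤ ∑ k, |(A' - A) i k * A'ᵀ k j| + ∑ k, |A i k * (A' - A)ᵀ k j| :=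
        (abs_add_le _ _).trans (add_le_add (Finset.abs_sum_le_sum_abs _ _) (Finset.abs_sum_le_sum_abs _ _))
    _ ≤ ∑ _k : ι, o * p + ∑ _k : ι, p * o := add_le_add (Finset.sum_le_sum fun k _ => h1 k) (Finset.sum_le_sum fun k _ => h2 k)
    _ = (Fintype.card ι : ℝ) * (o * p + p * o) := by rw [Finset.sum_const, Finset.sum_const, Finset.card_univ, nsmul_eq_mul, nsmul_eq_mul]; ring

/-- ★ ROW FIT OF THE ZEROTH-ORDER COEFFICIENT (orthogonal `S, R, S′, R′`) from the plain η-fit of `a⁺` (`≤ o_a`), the field letter `|a⁺| ≤ p` on both grids and the η-fit of the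
covariant-gradient field `g = η⁻²·(S_μ − R₋ᵀS₋R₋)` (`≤ o_g`): `≤ |ι|·|J|·(|ι|(o_a·p + p·o_a) + o_g)`. [cite: Balaban1985BackgroundPropagators, (3.35)–(3.37) p.396, (3.52) p.400 (shapes)] -/
theorem rowFit_curvCoefC {p oa og : ℝ} (hS : ∀ μ x, S μ x * (S μ x)ᵀ = 1) (hR : ∀ μ x, (R μ x)ᵀ * R μ x = 1) (hS' : ∀ μ x', S' μ x' * (S' μ x')ᵀ = 1)
    (hR' : ∀ μ x', (R' μ x')ᵀ * R' μ x' = 1) (hp : ∀ μ x i j, |curvCoefA η τ R S (Sum.inl μ) x i j| ≤ p)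
    (hp' : ∀ μ x' i j, |curvCoefA η' τ' R' S' (Sum.inl μ) x' i j| ≤ p)
    (hfa : ∀ μ x' i j, |(curvCoefA η' τ' R' S' (Sum.inl μ) x' - curvCoefA η τ R S (Sum.inl μ) (π x')) i j| ≤ oa)
    (hfg : ∀ μ x' i j, |((η'⁻¹ * η'⁻¹) • covShiftDefect τ' R' S' μ x' - (η⁻¹ * η⁻¹) • covShiftDefect τ R S μ (π x')) i j| ≤ og) (x' : X') (i : ι) :
    ∑ j, |curvCoefC η' τ' R' S' x' i j - curvCoefC η τ R S (π x') i j| ≤ (Fintype.card ι : ℝ) * ((Fintype.card J : ℝ) * ((Fintype.card ι : ℝ) * (oa * p + p * oa) + og)) := by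
  have hdiff : curvCoefC η' τ' R' S' x' - curvCoefC η τ R S (π x') =
      -∑ μ, ((curvCoefA η' τ' R' S' (Sum.inl μ) x' * (curvCoefA η' τ' R' S' (Sum.inl μ) x')ᵀ - curvCoefA η τ R S (Sum.inl μ) (π x') * (curvCoefA η τ R S (Sum.inl μ) (π x'))ᵀ) +
        (((η'⁻¹ * η'⁻¹) • covShiftDefect τ' R' S' μ x')ᵀ - ((η⁻¹ * η⁻¹) • covShiftDefect τ R S μ (π x'))ᵀ)) := by
    rw [curvCoefC_eq_neg_sum η' τ' R' S' hS' hR', curvCoefC_eq_neg_sum η τ R S hS hR, neg_sub_neg, ← Finset.sum_sub_distrib, ← Finset.sum_neg_distrib]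
    refine Finset.sum_congr rfl fun μ _ => ?_
    abel
  have hent : ∀ i j, |(curvCoefC η' τ' R' S' x' - curvCoefC η τ R S (π x')) i j| ≤ (Fintype.card J : ℝ) * ((Fintype.card ι : ℝ) * (oa * p + p * oa) + og) := fun i j => by
    rw [hdiff, Matrix.neg_apply, abs_neg, Matrix.sum_apply]
    calc _ ≤ ∑ μ, |((curvCoefA η' τ' R' S' (Sum.inl μ) x' * (curvCoefA η' τ' R' S' (Sum.inl μ) x')ᵀ -
            curvCoefA η τ R S (Sum.inl μ) (π x') * (curvCoefA η τ R S (Sum.inl μ) (π x'))ᵀ) +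
            (((η'⁻¹ * η'⁻¹) • covShiftDefect τ' R' S' μ x')ᵀ - ((η⁻¹ * η⁻¹) • covShiftDefect τ R S μ (π x'))ᵀ)) i j| := Finset.abs_sum_le_sum_abs _ _
      _ ≤ ∑ _μ : J, ((Fintype.card ι : ℝ) * (oa * p + p * oa) + og) := Finset.sum_le_sum fun μ _ => by
          rw [Matrix.add_apply]
          refine (abs_add_le _ _).trans (add_le_add (abs_mul_transpose_fit_le (hp μ _) (hp' μ _) (hfa μ x') i j) ?_)
          exact abs_transpose_sub_entry_le (fun i j => hfg μ x' i j) i j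
      _ = _ := by rw [Finset.sum_const, Finset.card_univ, nsmul_eq_mul]
  calc ∑ j, |curvCoefC η' τ' R' S' x' i j - curvCoefC η τ R S (π x') i j| ≤ ∑ _j : ι, (Fintype.card J : ℝ) * ((Fintype.card ι : ℝ) * (oa * p + p * oa) + og) :=
        Finset.sum_le_sum fun j _ => by rw [← Matrix.sub_apply]; exact hent i j
    _ = _ := by rw [Finset.sum_const, Finset.card_univ, nsmul_eq_mul]

variable (ι J) in
/-- ONE FIT LETTER FOR ALL CURVED COEFFICIENTS: `o_V = |ι|o_a + |ι|³(p·o_R + o_t + p·o_R) + |ι||J|(|ι|(o_a p + p o_a) + o_g)`. [folklore] -/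
def curvFitLetter (p oa oat oR og : ℝ) : ℝ :=
  (Fintype.card ι : ℝ) * oa + (Fintype.card ι : ℝ) ^ 3 * (oR * p * 1 + 1 * oat * 1 + 1 * p * oR) +
    (Fintype.card ι : ℝ) * ((Fintype.card J : ℝ) * ((Fintype.card ι : ℝ) * (oa * p + p * oa) + og))

omit [DecidableEq ι] in
/-- The fit letter is nonnegative for nonnegative inputs. [folklore] -/
theorem curvFitLetter_nonneg {p oa oat oR og : ℝ} (hp : 0 ≤ p) (hoa : 0 ≤ oa) (hoat : 0 ≤ oat) (hoR : 0 ≤ oR) (hog : 0 ≤ og) :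
    0 ≤ curvFitLetter ι J p oa oat oR og := by
  unfold curvFitLetter; positivity

end Fits

/-! ## §2 The η-defect of the dressed pair at a curved base point -/

section Defect

variable [Fintype X] [Fintype X'] [DecidableEq X] [DecidableEq X'] [DecidableEq J] {g : B6.Geometry} (blk : X → g.Site) (π : X' → X)
variable (η η' : ℝ) (τ : J → X ≃ X) (τ' : J → X' ≃ X') (R S : J → X → Matrix ι ι ℝ) (R' S' : J → X' → Matrix ι ι ℝ)
variable (G : (X × ι → ℝ) →ₗ[ℝ] (X × ι → ℝ)) (G' : (X' × ι → ℝ) →ₗ[ℝ] (X' × ι → ℝ))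

/-- DICTIONARY (flat base point): at `R ≡ 1` the curved dressed pair IS the lineage's flat-base-point pair — M1's `bgPairM` of `G`, the plain quotient pieces
`fgrad ∘ G`, `bgrad ∘ G` (FILE 18∕24's `hDf`∕`hDb`) and FILE 28's exact transport coefficients of the perturbation read as a gauge field. [folklore] -/
theorem curvDressed_one :
    curvDressed η τ (fun _ _ => 1) S G =
      bgPairM G (Sum.elim (fun μ => fgrad η⁻¹ (liftEquiv (τ μ) ι) ∘ₗ G) (fun μ => bgrad η⁻¹ (liftEquiv (τ μ) ι) ∘ₗ G)) (tCoefC η (gaugePair τ S))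
        (tCoefA η (gaugePair τ S)) := by
  unfold curvDressed
  rw [gaugePair_one, covPieces_one, curvCoefC_one, curvCoefA_one]

/-- THE STACKED UNKNOWN IS `(X, D⁺_RX, D⁻_RX)`: under the Neumann unit hypothesis the forward derived component of the dressed pair IS the background's forward covariant
derivative of its propagator component, `pr_{inl μ}X̂ = D⁺_{R,μ} ∘ pr₀X̂` (M1 `projO_some_bgPairM` + `projO_none_bgPairM`). [cite: Balaban1985BackgroundPropagators, (3.64) p.403 (shape)] -/
theorem projO_inl_curvDressed (hunit : IsUnit (1 - LinearMap.toMatrix' (stack G (covPieces η τ (gaugePair τ R) G) ∘ₗ unstackM (curvCoefC η τ R S) (curvCoefA η τ R S))))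
    (μ : J) :
    projO (some (Sum.inl μ)) ∘ₗ curvDressed η τ R S G = covD η (R μ) (τ μ) ∘ₗ (projO none ∘ₗ curvDressed η τ R S G) := by
  have h0 : projO none ∘ₗ curvDressed η τ R S G = G + G ∘ₗ (unstackM (curvCoefC η τ R S) (curvCoefA η τ R S) ∘ₗ curvDressed η τ R S G) := projO_none_bgPairM hunit
  have h1 : projO (some (Sum.inl μ)) ∘ₗ curvDressed η τ R S G = covPieces η τ (gaugePair τ R) G (Sum.inl μ) +
      covPieces η τ (gaugePair τ R) G (Sum.inl μ) ∘ₗ (unstackM (curvCoefC η τ R S) (curvCoefA η τ R S) ∘ₗ curvDressed η τ R S G) := projO_some_bgPairM hunit (Sum.inl μ)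
  rw [h1, h0, covPieces_inl, show gaugePair τ R (Sum.inl μ) = R μ from rfl, LinearMap.comp_add, LinearMap.comp_assoc]

/-- … and the backward derived component IS `D⁻_{R,μ} ∘ pr₀X̂` (`D⁻_{R,μ} = −covD η R₋ᵀ τ_μ⁻¹`). [cite: Balaban1985BackgroundPropagators, (3.64) p.403 (shape)] -/
theorem projO_inr_curvDressed (hunit : IsUnit (1 - LinearMap.toMatrix' (stack G (covPieces η τ (gaugePair τ R) G) ∘ₗ unstackM (curvCoefC η τ R S) (curvCoefA η τ R S))))
    (μ : J) :
    projO (some (Sum.inr μ)) ∘ₗ curvDressed η τ R S G = -(covD η (fun x => (R μ ((τ μ).symm x))ᵀ) (τ μ).symm ∘ₗ (projO none ∘ₗ curvDressed η τ R S G)) := by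
  have h0 : projO none ∘ₗ curvDressed η τ R S G = G + G ∘ₗ (unstackM (curvCoefC η τ R S) (curvCoefA η τ R S) ∘ₗ curvDressed η τ R S G) := projO_none_bgPairM hunit
  have h1 : projO (some (Sum.inr μ)) ∘ₗ curvDressed η τ R S G = covPieces η τ (gaugePair τ R) G (Sum.inr μ) +
      covPieces η τ (gaugePair τ R) G (Sum.inr μ) ∘ₗ (unstackM (curvCoefC η τ R S) (curvCoefA η τ R S) ∘ₗ curvDressed η τ R S G) := projO_some_bgPairM hunit (Sum.inr μ)
  rw [h1, h0, covPieces_inr, show gaugePair τ R (Sum.inr μ) = fun x => (R μ ((τ μ).symm x))ᵀ from rfl, LinearMap.comp_add, LinearMap.neg_comp, neg_add,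
    LinearMap.comp_assoc]

/-- ★★★ **THE η-DEFECT OF THE DRESSED PAIR AT A CURVED BASE POINT — NE2⁺ (entries 0∕1, block form) PROPAGATES FROM `U` TO `U′U`.**  Data: a [B6] carrier ((2.54), (2.61) with row
sums `c_r` at rate `σ ≥ 0`), the coarse∕fine product carriers blocked through `blk`, `blk ∘ π`; at BOTH spacings the propagator `G = G(U)` and its covariant pieces `D^±_RG` with the
(3.42)₀,₁-shaped block majorants `β·e^{−δd}` and with η-DEFECTS `𝔇(G′, G), 𝔇(D′_j, D_j) ≤ m·e^{−δd}` (NE2⁺ AT THE BASE POINT, entries 0∕1, `m` carries the rate factor);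
orthogonal transporters with file 1's letters (`|S − 1| ≤ ηp₀`, `|S_μ − R₋ᵀS₋R₋| ≤ η²q₀`) on both grids, the field letter `|a⁺| ≤ p`, and the transporter-level η-FITS of §1
(`o_a, o_t, o_R, o_g`); rate `0 ≤ ρ`, `ρ + σ ≤ δ`; smallness `q = β·r_V(1 + |J ⊕ J|)·c_r < 1`.  CONCLUSION: the η-defect of the dressed pairs `X̂(U′U)` through
`(pull (liftMap π ι), pull (liftPair (liftMap π ι)))` is `≤ (m c_r + m c_r·(R_Vβ(1−q)⁻¹) + β·O_V·β(1−q)⁻¹·c_r)(1−q)⁻¹·e^{−ρd}`, `R_V = r_V(1 + |J ⊕ J|)`, `O_V = o_V(1 + |J ⊕ J|)`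
— M1's `hasMaj_idef_bgPairM` VERBATIM with covariant pieces and file 1's coefficients. [cite: Balaban1985BackgroundPropagators, (3.52)–(3.53) p.400, (3.63)–(3.65) pp.402–403 (shapes, mechanism); Balaban1984PropagatorsII, (2.52)–(2.56) pp.232–233] -/
theorem hasMaj_idef_curvDressed (htri : Triangle254 g) (hd : ∀ a b : g.Site, 0 ≤ g.dist a b) {σ cr : ℝ} (hσ : 0 ≤ σ) (hcr : 0 ≤ cr) (hrow : RowSum g σ cr)
    {ρ δ β m p₀ q₀ p oa oat oR og : ℝ} (hρ : 0 ≤ ρ) (hρδ : ρ + σ ≤ δ) (hβ : 0 ≤ β) (hm : 0 ≤ m) (hη : 0 < η) (hη' : 0 < η') (hp₀ : 0 ≤ p₀) (hq₀ : 0 ≤ q₀)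
    (hp : 0 ≤ p) (hoa : 0 ≤ oa) (hoat : 0 ≤ oat) (hoR : 0 ≤ oR) (hog : 0 ≤ og)
    -- the U-layer at the curved base point, both grids, and its η-defects (entries 0∕1 of NE2⁺ at U)
    (hG : HasMaj (BlockNorm.ofBlocks g (liftBlk blk ι)) (BlockNorm.ofBlocks g (liftBlk blk ι)) G (fun y y' => β * Real.exp (-(δ * g.dist y y'))))
    (hD : ∀ j, HasMaj (BlockNorm.ofBlocks g (liftBlk blk ι)) (BlockNorm.ofBlocks g (liftBlk blk ι)) (covPieces η τ (gaugePair τ R) G j)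
      (fun y y' => β * Real.exp (-(δ * g.dist y y'))))
    (hG' : HasMaj (BlockNorm.ofBlocks g (liftBlk (blk ∘ π) ι)) (BlockNorm.ofBlocks g (liftBlk (blk ∘ π) ι)) G' (fun y y' => β * Real.exp (-(δ * g.dist y y'))))
    (hD' : ∀ j, HasMaj (BlockNorm.ofBlocks g (liftBlk (blk ∘ π) ι)) (BlockNorm.ofBlocks g (liftBlk (blk ∘ π) ι)) (covPieces η' τ' (gaugePair τ' R') G' j)
      (fun y y' => β * Real.exp (-(δ * g.dist y y'))))
    (hDG : HasMaj (BlockNorm.ofBlocks g (liftBlk blk ι)) (BlockNorm.ofBlocks g (liftBlk (blk ∘ π) ι))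
      (idef (pull (liftMap π ι)) (pull (liftMap π ι)) G' G) (fun y y' => m * Real.exp (-(δ * g.dist y y'))))
    (hDD : ∀ j, HasMaj (BlockNorm.ofBlocks g (liftBlk blk ι)) (BlockNorm.ofBlocks g (liftBlk (blk ∘ π) ι))
      (idef (pull (liftMap π ι)) (pull (liftMap π ι)) (covPieces η' τ' (gaugePair τ' R') G' j) (covPieces η τ (gaugePair τ R) G j))
      (fun y y' => m * Real.exp (-(δ * g.dist y y'))))
    -- file 1's transporter letters, both grids
    (hS : ∀ μ x, S μ x * (S μ x)ᵀ = 1) (hRo : ∀ μ x, (R μ x)ᵀ * R μ x = 1) (hRo' : ∀ μ x, R μ x * (R μ x)ᵀ = 1)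
    (hSp : ∀ μ x i j, |(S μ x - 1) i j| ≤ η * p₀) (hSq : ∀ μ x i j, |covShiftDefect τ R S μ x i j| ≤ η ^ 2 * q₀)
    (hS' : ∀ μ x', S' μ x' * (S' μ x')ᵀ = 1) (hRf : ∀ μ x', (R' μ x')ᵀ * R' μ x' = 1) (hRf' : ∀ μ x', R' μ x' * (R' μ x')ᵀ = 1)
    (hSp' : ∀ μ x' i j, |(S' μ x' - 1) i j| ≤ η' * p₀) (hSq' : ∀ μ x' i j, |covShiftDefect τ' R' S' μ x' i j| ≤ η' ^ 2 * q₀)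
    -- the field letter and the transporter-level η-fits
    (hap : ∀ μ x i j, |curvCoefA η τ R S (Sum.inl μ) x i j| ≤ p) (hap' : ∀ μ x' i j, |curvCoefA η' τ' R' S' (Sum.inl μ) x' i j| ≤ p)
    (hfa : ∀ μ x' i j, |(curvCoefA η' τ' R' S' (Sum.inl μ) x' - curvCoefA η τ R S (Sum.inl μ) (π x')) i j| ≤ oa)
    (hfat : ∀ μ x' i j, |(curvCoefA η' τ' R' S' (Sum.inl μ) ((τ' μ).symm x') - curvCoefA η τ R S (Sum.inl μ) ((τ μ).symm (π x'))) i j| ≤ oat)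
    (hfR : ∀ μ x' i j, |(R' μ ((τ' μ).symm x') - R μ ((τ μ).symm (π x'))) i j| ≤ oR)
    (hfg : ∀ μ x' i j, |((η'⁻¹ * η'⁻¹) • covShiftDefect τ' R' S' μ x' - (η⁻¹ * η⁻¹) • covShiftDefect τ R S μ (π x')) i j| ≤ og)
    (hq : β * (curvRowLetter ι J p₀ q₀ * (1 + Fintype.card (J ⊕ J))) * cr < 1) :
    HasMaj (BlockNorm.ofBlocks g (liftBlk blk ι)) (BlockNorm.ofBlocks g (blkPair (liftBlk (blk ∘ π) ι)))
      (idef (pull (liftMap π ι)) (pull (liftPair (liftMap π ι))) (curvDressed η' τ' R' S' G') (curvDressed η τ R S G))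
      (fun y y' => (m * cr + 1 * (m * cr) * (curvRowLetter ι J p₀ q₀ * (1 + Fintype.card (J ⊕ J)) *
          (β * (1 - β * (curvRowLetter ι J p₀ q₀ * (1 + Fintype.card (J ⊕ J))) * cr)⁻¹)) +
          β * (curvFitLetter ι J p oa oat oR og * (1 + Fintype.card (J ⊕ J))) * (β * (1 - β * (curvRowLetter ι J p₀ q₀ * (1 + Fintype.card (J ⊕ J))) * cr)⁻¹) * cr) *
        (1 - 1 * (β * (curvRowLetter ι J p₀ q₀ * (1 + Fintype.card (J ⊕ J))) * cr))⁻¹ * Real.exp (-(ρ * g.dist y y'))) := by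
  -- row letters on both grids (file 1 §4), each ≤ r_V
  have hι : 0 ≤ (Fintype.card ι : ℝ) := Nat.cast_nonneg _
  have e0 : 0 ≤ (Fintype.card ι : ℝ) * p₀ := mul_nonneg hι hp₀
  have e1 : 0 ≤ (Fintype.card ι : ℝ) ^ 3 * p₀ := mul_nonneg (pow_nonneg hι 3) hp₀
  have e2 : 0 ≤ (Fintype.card ι : ℝ) * ((Fintype.card J : ℝ) * ((Fintype.card ι : ℝ) * p₀ ^ 2 + q₀)) := by positivity
  have h1 : (Fintype.card ι : ℝ) * p₀ ≤ curvRowLetter ι J p₀ q₀ := by unfold curvRowLetter; linarith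
  have h2 : (Fintype.card ι : ℝ) ^ 3 * p₀ ≤ curvRowLetter ι J p₀ q₀ := by unfold curvRowLetter; linarith
  have h3 : (Fintype.card ι : ℝ) * ((Fintype.card J : ℝ) * ((Fintype.card ι : ℝ) * p₀ ^ 2 + q₀)) ≤ curvRowLetter ι J p₀ q₀ := by unfold curvRowLetter; linarith
  have hR1 : ∀ μ x i j, |R μ x i j| ≤ 1 := fun μ x i j => abs_entry_le_one_of_orthogonal (hRo' μ x) i j
  have hR1' : ∀ μ x' i j, |R' μ x' i j| ≤ 1 := fun μ x' i j => abs_entry_le_one_of_orthogonal (hRf' μ x') i j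
  have hC : ∀ x i, ∑ j, |curvCoefC η τ R S x i j| ≤ curvRowLetter ι J p₀ q₀ := fun x i => (rowSum_curvCoefC_le τ R S hη hS hRo hSp hSq x i).trans h3
  have hC' : ∀ x' i, ∑ j, |curvCoefC η' τ' R' S' x' i j| ≤ curvRowLetter ι J p₀ q₀ := fun x' i => (rowSum_curvCoefC_le τ' R' S' hη' hS' hRf hSp' hSq' x' i).trans h3
  have hA : ∀ (jj : J ⊕ J) x i, ∑ j, |curvCoefA η τ R S jj x i j| ≤ curvRowLetter ι J p₀ q₀ := fun jj x i => by
    cases jj with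
    | inl μ => exact (rowSum_curvCoefA_inl_le τ R S hη hSp μ x i).trans h1
    | inr μ => exact (rowSum_curvCoefA_inr_le τ R S hη hR1 hSp μ x i).trans h2
  have hA' : ∀ (jj : J ⊕ J) x' i, ∑ j, |curvCoefA η' τ' R' S' jj x' i j| ≤ curvRowLetter ι J p₀ q₀ := fun jj x' i => by
    cases jj with
    | inl μ => exact (rowSum_curvCoefA_inl_le τ' R' S' hη' hSp' μ x' i).trans h1
    | inr μ => exact (rowSum_curvCoefA_inr_le τ' R' S' hη' hR1' hSp' μ x' i).trans h2
  -- fit letters (§1), each ≤ o_V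
  have f0 : 0 ≤ (Fintype.card ι : ℝ) * oa := mul_nonneg hι hoa
  have f1 : 0 ≤ (Fintype.card ι : ℝ) ^ 3 * (oR * p * 1 + 1 * oat * 1 + 1 * p * oR) := by positivity
  have f2 : 0 ≤ (Fintype.card ι : ℝ) * ((Fintype.card J : ℝ) * ((Fintype.card ι : ℝ) * (oa * p + p * oa) + og)) := by positivity
  have g1 : (Fintype.card ι : ℝ) * oa ≤ curvFitLetter ι J p oa oat oR og := by unfold curvFitLetter; linarith
  have g2 : (Fintype.card ι : ℝ) ^ 3 * (oR * p * 1 + 1 * oat * 1 + 1 * p * oR) ≤ curvFitLetter ι J p oa oat oR og := by unfold curvFitLetter; linarith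
  have g3 : (Fintype.card ι : ℝ) * ((Fintype.card J : ℝ) * ((Fintype.card ι : ℝ) * (oa * p + p * oa) + og)) ≤ curvFitLetter ι J p oa oat oR og := by
    unfold curvFitLetter; linarith
  have hfC : ∀ x' i, ∑ j, |curvCoefC η' τ' R' S' x' i j - curvCoefC η τ R S (π x') i j| ≤ curvFitLetter ι J p oa oat oR og := fun x' i =>
    (rowFit_curvCoefC η η' τ τ' π R S R' S' hS hRo hS' hRf hap hap' hfa hfg x' i).trans g3
  have hfA : ∀ (jj : J ⊕ J) x' i, ∑ j, |curvCoefA η' τ' R' S' jj x' i j - curvCoefA η τ R S jj (π x') i j| ≤ curvFitLetter ι J p oa oat oR og := fun jj x' i => by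
    cases jj with
    | inl μ => exact (rowFit_curvCoefA_inl η η' τ τ' π R S R' S' hfa μ x' i).trans g1
    | inr μ => exact (rowFit_curvCoefA_inr η η' τ τ' π R S R' S' hR1 hR1' hap hap' hfat hfR μ x' i).trans g2
  exact hasMaj_idef_bgPairM blk π htri hd hσ hcr hrow hρ hρδ hβ (curvRowLetter_nonneg (ι := ι) (J := J) hp₀ hq₀)
    (curvFitLetter_nonneg (ι := ι) (J := J) hp hoa hoat hoR hog) hm hG hD hG' hD' hDG hDD hC hA hC' hA' hfC hfA hq

/-- ENTRIES OF THE DEFECT: a block majorant of the dressed pairs' η-defect passes to each component (`none` = the dressed propagator, `some (inl∕inr μ)` = its covariant derivatives,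
`projO_inl∕inr_curvDressed`) — entries 0∕1 of NE2⁺ at `U′U` (B2 `hasMaj_projO_comp`). [cite: Balaban1985BackgroundPropagators, Thm 3.1 (3.42) p.397 (first two entries: shape)] -/
theorem hasMaj_idef_curvDressed_proj {K : g.Site → g.Site → ℝ}
    (key : HasMaj (BlockNorm.ofBlocks g (liftBlk blk ι)) (BlockNorm.ofBlocks g (blkPair (liftBlk (blk ∘ π) ι)))
      (idef (pull (liftMap π ι)) (pull (liftPair (liftMap π ι))) (curvDressed η' τ' R' S' G') (curvDressed η τ R S G)) K) (j : Option (J ⊕ J)) :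
    HasMaj (BlockNorm.ofBlocks g (liftBlk blk ι)) (BlockNorm.ofBlocks g (liftBlk (blk ∘ π) ι))
      (idef (pull (liftMap π ι)) (pull (liftMap π ι)) (projO j ∘ₗ curvDressed η' τ' R' S' G') (projO j ∘ₗ curvDressed η τ R S G)) K := by
  have hcomp : idef (pull (liftMap π ι)) (pull (liftMap π ι)) (projO j ∘ₗ curvDressed η' τ' R' S' G') (projO j ∘ₗ curvDressed η τ R S G) =
      projO j ∘ₗ idef (pull (liftMap π ι)) (pull (liftPair (liftMap π ι))) (curvDressed η' τ' R' S' G') (curvDressed η τ R S G) :=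
    LinearMap.ext fun v => funext fun x' => rfl
  rw [hcomp]
  exact hasMaj_projO_comp (liftBlk (blk ∘ π) ι) key j

end Defect

end Summit.QuantumFields.YangMills.BalabanUVNodes.N15.CurvedSpecies

end
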